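import Summits.Ventures.DiscreteObjects.UnitDistance.QuadraticPlanesFourH
import Summits.Ventures.DiscreteObjects.UnitDistance.PlaneSqrt287Four
import Summits.Ventures.DiscreteObjects.UnitDistance.PlaneSqrt299Four
import HarnessLib

/-!
# Quadratic planes with chromatic number four, IX: `d = 287, 299` and the ledger of open rows below `400`
(cell `pub-namedobj`, target (U), seat udg g18 — summary)

Framing (verbatim for the cell): lottery ticket; floor = certified bounds/negative ranges.

Two more rows of the quadratic table are exact: `χ(ℚ(√287)²) = χ(ℚ(√299)²) = 4` (`PlaneSqrt287Four.lean`: `W₂₈₇` on `2232` vertices, a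
1,240-step kernel RUP certificate, upper bound the ramified `7`-adic frame `−7` of `QuadraticPlanesFourG`; `PlaneSqrt299Four.lean`: `W₂₉₉` on
`1000` vertices, 3,127 steps, upper bound the 2-adic criterion, `299 ≡ 3 (mod 8)`).  Both graphs descend from the unit-distance graphs that udg
g16 could only record as computations (`QuadraticPlanesFourH`: cores of `2,005–2,331` vertices whose CDCL refutations — `4–14 · 10⁵` hint
numbers — exceeded the certificate format of `KernelRupCheck.lean`).  What changed (udg g18): (i) the LIGHT certificate format
`KernelRupQuad.lean` / `KernelRupQuadCnf.lean` (quaternary clause trie, kernel-primitive arithmetic, one-pass CNF; the old format spent `Θ(n²)`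
kernel steps on the CNF alone and several hundred cached kernel steps per hint), with independent pieces; (ii) for `299`, two rounds of
ENRICHMENT of the core by the lattice points at unit distance from at least two of its vertices, each followed by proof-guided shrinking
(`2,331 → 1,104 → 1,000` vertices, proof `1.35 · 10⁶ → 1.7 · 10⁵` numbers), and the choice of a maximum-degree edge for the symmetry breaking.

CONSEQUENCES.  `chromaticNumber_plane_multiSqrtField_eq_four_seventeen`: seventeen exact rows with value four are now in the tree.
`quadratic_open_rows_lt_400''`: the fifteen rows below `400` that are still not exact, with the interval the tree proves — `{3, 4}` for
`83, 107, 227, 251, 323, 347, 371, 395`; `{4, 5}` for `47, 143, 311, 335`; `[3, 5]` for `215, 383`; `[3, 7]` for `167`.  Values `≥ 4` not found in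
print (PROVISIONAL).
-/

noncomputable section

namespace Summit.Ventures.DiscreteObjects.UnitDistance

open SimpleGraph IntermediateField
open scoped IntermediateField

/-- TWO MORE EXACT QUADRATIC ROWS: `χ(ℚ(√287)²) = χ(ℚ(√299)²) = 4`. -/
theorem chromaticNumber_plane_sqrt_287_299 :
    (planeUnitDistanceGraph.induce (fieldPoints ℚ⟮Real.sqrt 287⟯)).chromaticNumber = 4 ∧
    (planeUnitDistanceGraph.induce (fieldPoints ℚ⟮Real.sqrt 299⟯)).chromaticNumber = 4 :=
  ⟨chromaticNumber_plane_sqrt287, chromaticNumber_plane_sqrt299⟩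

/-- The seventeen exact rows with value four now in the tree (`11, 23, 35, 59, 71, 95, 119, 131, 179, 191` of udg g12–g14; `239, 359` of udg g15;
`155, 203, 263` of udg g16; `287, 299` of udg g18), atlas vocabulary. -/
theorem chromaticNumber_plane_multiSqrtField_eq_four_seventeen :
    ∀ d ∈ ({11, 23, 35, 59, 71, 95, 119, 131, 155, 179, 191, 203, 239, 263, 287, 299, 359} : Finset ℕ),
      (planeUnitDistanceGraph.induce (fieldPoints (multiSqrtField {d}))).chromaticNumber = 4 := by
  intro d hd
  simp only [Finset.mem_insert, Finset.mem_singleton] at hd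
  rcases hd with rfl | rfl | rfl | rfl | rfl | rfl | rfl | rfl | rfl | rfl | rfl | rfl | rfl | rfl | rfl | rfl | rfl
  · exact chromaticNumber_plane_multiSqrtField_11
  · exact chromaticNumber_plane_multiSqrtField_23
  · exact chromaticNumber_plane_multiSqrtField_35
  · exact chromaticNumber_plane_multiSqrtField_59
  · exact chromaticNumber_plane_multiSqrtField_71
  · exact chromaticNumber_plane_multiSqrtField_95
  · exact chromaticNumber_plane_multiSqrtField_119
  · exact chromaticNumber_plane_multiSqrtField_131
  · exact chromaticNumber_plane_multiSqrtField_155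
  · exact chromaticNumber_plane_multiSqrtField_179
  · exact chromaticNumber_plane_multiSqrtField_191
  · exact chromaticNumber_plane_multiSqrtField_203
  · exact chromaticNumber_plane_multiSqrtField_239
  · exact chromaticNumber_plane_multiSqrtField_263
  · exact chromaticNumber_plane_multiSqrtField_287
  · exact chromaticNumber_plane_multiSqrtField_299
  · exact chromaticNumber_plane_multiSqrtField_359

/-- THE OPEN ROWS BELOW `400`, AMENDED (fifteen values; `287, 299` are exact since this file): `3 ≤ χ ≤ 4` for `83, 107, 227, 251, 323, 347, 371, 395`;
`4 ≤ χ ≤ 5` for `47, 143, 311, 335`; `3 ≤ χ ≤ 5` for `215, 383`; `3 ≤ χ ≤ 7` for `167`.  Every other square-free `d ≡ 3 (mod 4)` below `400` has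
`χ(ℚ(√d)²) = 3` (`d ≢ 2 (mod 3)`) or `= 4` (the seventeen of `chromaticNumber_plane_multiSqrtField_eq_four_seventeen`). -/
theorem quadratic_open_rows_lt_400'' :
    (∀ d ∈ ({83, 107, 227, 251, 323, 347, 371, 395} : Finset ℕ),
        ¬ (planeUnitDistanceGraph.induce (fieldPoints (multiSqrtField {d}))).Colorable 2 ∧
          (planeUnitDistanceGraph.induce (fieldPoints (multiSqrtField {d}))).Colorable 4) ∧
    (∀ d ∈ ({47, 143, 311, 335} : Finset ℕ),
        4 ≤ (planeUnitDistanceGraph.induce (fieldPoints (multiSqrtField {d}))).chromaticNumber ∧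
          (planeUnitDistanceGraph.induce (fieldPoints (multiSqrtField {d}))).chromaticNumber ≤ 5) ∧
    (∀ d ∈ ({215, 383} : Finset ℕ),
        ¬ (planeUnitDistanceGraph.induce (fieldPoints (multiSqrtField {d}))).Colorable 2 ∧
          (planeUnitDistanceGraph.induce (fieldPoints (multiSqrtField {d}))).Colorable 5) ∧
    (¬ (planeUnitDistanceGraph.induce (fieldPoints (multiSqrtField {167}))).Colorable 2 ∧
      (planeUnitDistanceGraph.induce (fieldPoints (multiSqrtField {167}))).chromaticNumber ≤ 7) := by
  obtain ⟨h34, h45, h35, h167⟩ := quadratic_open_rows_lt_400'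
  refine ⟨?_, h45, h35, h167⟩
  intro d hd
  simp only [Finset.mem_insert, Finset.mem_singleton] at hd
  rcases hd with rfl | rfl | rfl | rfl | rfl | rfl | rfl | rfl <;> exact h34 _ (by decide)

end Summit.Ventures.DiscreteObjects.UnitDistance
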